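import Summits.PneNP.PneNP.Theorems.SzkEntropyPeaThreeNotInPTensorIsoDefs
import Mathlib.LinearAlgebra.Matrix.Rank
import Mathlib.LinearAlgebra.Matrix.NonsingularInverse
import Mathlib.LinearAlgebra.Matrix.Kronecker
import Mathlib.Algebra.Field.ZMod

/-!
# Route SzkEntropy, crux `PeaThreeNotInP` (stmt-PneNP-10776), line `SketchIdeator3`: stub `stub_event`

The "event analysis" of the monoid-randomised sampler: for a CONCISE tensor `X` of format
`a × b × c` over `F₂` and an arbitrary matrix triple `M = (A, B, C)`, the smeared tensor
`M·X = A · X · (B ⊗ C)ᵀ` is concise iff all three matrices are invertible.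

Proof: the three flattenings of `M·X` are `A · X · (B ⊗ C)ᵀ`, `B · flat₂ X · (A ⊗ C)ᵀ`,
`C · flat₃ X · (A ⊗ B)ᵀ`; the rank of a product is at most the rank of its left factor, which for a
square matrix of size `a` is at most `a` with equality iff the matrix is invertible; conversely
invertible factors (Kronecker products and transposes of invertible matrices are invertible)
preserve the rank.  Sources: J. A. Grochow, Y. Qiao, *On the complexity of isomorphism problems for
tensors, groups, and polynomials I*, SIAM J. Comput. 52 (2023), §2 (flattenings, nondegenerate
tensors); the card `Cruxes/PeaThreeNotInP/Ideas/tensor-orbit-two-query.md`, step S2.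
-/

noncomputable section

open Finset Matrix
open scoped Kronecker
open _root_.Computability Literature.InformationTheory.Entropy Literature.Computability.Complexity

namespace Summit.PneNP.PneNP.Cruxes.PeaThreeNotInP.TensorIsoLine

set_option linter.dupNamespace false -- `Summit.PneNP.PneNP.…`: summit = sub-problem name (D-0017 single-conjunct layout)

variable {a b c : ℕ}

/-! ### Flattening identities -/

/-- Second flattening of the smeared tensor: `flat₂ ((A,B,C)·X) = B · flat₂ X · (A ⊗ C)ᵀ`.
[GrochowQiao2023, §2] -/
theorem flat₂_tensorAct (M : Triple a b c) (X : Tensor3 a b c) :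
    flat₂ (tensorAct M X) = M.2.1 * flat₂ X * (M.1 ⊗ₖ M.2.2)ᵀ := by
  ext j ⟨i, k⟩
  simp only [flat₂, tensorAct, of_apply, mul_apply, transpose_apply, kroneckerMap_apply,
    Finset.sum_mul, Fintype.sum_prod_type]
  rw [Finset.sum_comm]
  refine Eq.trans ?_ Finset.sum_comm
  refine Finset.sum_congr rfl fun k' _ => ?_
  rw [Finset.sum_comm]
  refine Finset.sum_congr rfl fun i' _ => Finset.sum_congr rfl fun j' _ => ?_
  ring

/-- Third flattening of the smeared tensor: `flat₃ ((A,B,C)·X) = C · flat₃ X · (A ⊗ B)ᵀ`.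
[GrochowQiao2023, §2] -/
theorem flat₃_tensorAct (M : Triple a b c) (X : Tensor3 a b c) :
    flat₃ (tensorAct M X) = M.2.2 * flat₃ X * (M.1 ⊗ₖ M.2.1)ᵀ := by
  ext k ⟨i, j⟩
  simp only [flat₃, tensorAct, of_apply, mul_apply, transpose_apply, kroneckerMap_apply,
    Finset.sum_mul, Fintype.sum_prod_type]
  symm
  rw [Finset.sum_comm]
  refine Finset.sum_congr rfl fun j' _ => ?_
  rw [Finset.sum_comm]
  refine Finset.sum_congr rfl fun k' _ => Finset.sum_congr rfl fun i' _ => ?_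
  ring

/-! ### Rank facts for square matrices over `F₂` -/

/-- A square matrix over `F₂` of full rank is invertible. [folklore] -/
theorem isUnit_of_rank_eq {n : ℕ} {A : Matrix (Fin n) (Fin n) (ZMod 2)} (h : A.rank = n) :
    IsUnit A := by
  rw [← Matrix.linearIndependent_rows_iff_isUnit, linearIndependent_iff_card_eq_finrank_span,
    Set.finrank, ← Matrix.rank_eq_finrank_span_row, h, Fintype.card_fin]

/-- The rank of `A · Y · N` is at most the size of the square left factor `A`; if it is full, `A` is
invertible. [folklore] -/
theorem isUnit_of_rank_mul_mul_eq {n : ℕ} {ι κ : Type*} [Fintype ι] [Fintype κ]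
    (A : Matrix (Fin n) (Fin n) (ZMod 2)) (Y : Matrix (Fin n) ι (ZMod 2)) (N : Matrix ι κ (ZMod 2))
    (h : (A * Y * N).rank = n) : IsUnit A :=
  isUnit_of_rank_eq <| le_antisymm (Matrix.rank_le_height A) <|
    h.ge.trans <| (Matrix.rank_mul_le_left _ _).trans (Matrix.rank_mul_le_left _ _)

/-- Sandwiching between invertible matrices preserves the rank. [folklore] -/
theorem rank_mul_mul_of_isUnit {n : ℕ} {ι : Type*} [Fintype ι] [DecidableEq ι]
    {A : Matrix (Fin n) (Fin n) (ZMod 2)} (Y : Matrix (Fin n) ι (ZMod 2)) {N : Matrix ι ι (ZMod 2)}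
    (hA : IsUnit A) (hN : IsUnit N) : (A * Y * N).rank = Y.rank := by
  rw [Matrix.rank_mul_eq_left_of_isUnit_det N _ ((Matrix.isUnit_iff_isUnit_det N).mp hN),
    Matrix.rank_mul_eq_right_of_isUnit_det A _ ((Matrix.isUnit_iff_isUnit_det A).mp hA)]

/-- The transpose of the Kronecker product of two invertible matrices is invertible. [folklore] -/
theorem isUnit_kronecker_transpose {m n : Type*} [Fintype m] [Fintype n] [DecidableEq m]
    [DecidableEq n] {P : Matrix m m (ZMod 2)} {Q : Matrix n n (ZMod 2)} (hP : IsUnit P)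
    (hQ : IsUnit Q) : IsUnit (P ⊗ₖ Q)ᵀ := by
  rw [Matrix.isUnit_transpose, Matrix.isUnit_iff_isUnit_det, Matrix.det_kronecker]
  exact (((Matrix.isUnit_iff_isUnit_det P).mp hP).pow _).mul
    (((Matrix.isUnit_iff_isUnit_det Q).mp hQ).pow _)

/-! ### The event analysis -/

/-- **stub_event** (P2): for a CONCISE tensor `X`, the smeared tensor `M·X` is concise iff all three
matrices of `M` are invertible (flattening ranks: `flat₁(M·X) = A·X·(B⊗C)ᵀ`,
`flat₂(M·X) = B·flat₂X·(A⊗C)ᵀ`, `flat₃(M·X) = C·flat₃X·(A⊗B)ᵀ`; rank of a product is at most the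
rank of each factor, and invertible factors preserve rank). [card tensor-orbit-two-query, S2] -/
theorem stub_event {a b c : ℕ} (X : Tensor3 a b c) (hX : Concise X) (M : Triple a b c) :
    Concise (tensorAct M X) ↔ IsUnitTriple M := by
  obtain ⟨A, B, C⟩ := M
  simp only [Concise, IsUnitTriple, flat₂_tensorAct, flat₃_tensorAct]
  constructor
  · rintro ⟨h₁, h₂, h₃⟩
    exact ⟨isUnit_of_rank_mul_mul_eq A X _ h₁, isUnit_of_rank_mul_mul_eq B (flat₂ X) _ h₂,
      isUnit_of_rank_mul_mul_eq C (flat₃ X) _ h₃⟩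
  · rintro ⟨hA, hB, hC⟩
    obtain ⟨hX₁, hX₂, hX₃⟩ := hX
    refine ⟨?_, ?_, ?_⟩
    · simpa only [tensorAct, rank_mul_mul_of_isUnit X hA (isUnit_kronecker_transpose hB hC)]
        using hX₁
    · simpa only [rank_mul_mul_of_isUnit (flat₂ X) hB (isUnit_kronecker_transpose hA hC)]
        using hX₂
    · simpa only [rank_mul_mul_of_isUnit (flat₃ X) hC (isUnit_kronecker_transpose hA hB)]
        using hX₃

end Summit.PneNP.PneNP.Cruxes.PeaThreeNotInP.TensorIsoLine

end
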